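import Summits.AnomalousDissipation.AnomalousDissipation.Theorems.MomentParityQuarticGateAxialQuadOffA

/-!
# Axial quadratic rigidity (stub S2q of line `axis-sectors`, crux `MomentParity.QuarticGate`):
# off-centre axial sectors, part B — the thin lens `θ ∉ ball`, collinear pairs, assembly

* `self_block_two` — the one block that needs two equal pairs: `Q (0,2,0) (0,2,0)` at `N = 2`
  (sector `(0,4,0)`), killed by the pairs `(1,1,0)+(-1,1,0)`, `(0,1,1)+(0,1,-1)` whose polarisations
  `e₂, e₀` are independent;
* `offcentre_of_not_mem` — for an axial `θ = (0,m,0)` with `m > 0` OUTSIDE the ball (`N < m ≤ 2N`),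
  all blocks of the sector die by induction on the height `a₁` of the lower member: a non-collinear
  lower member `(a₀, h, a₂)` peels as `(a₀, h - t, a₂) + (0, t, 0)` (`t = h/2`), a collinear one
  `(0, h, 0)` as `(1, 0, 0) + (-1, h, 0)` (the companion `(-1, m, 0)` is outside the ball);
* `offcentre_collinear_of_mem` — collinear pairs for `θ` inside the ball, same decomposition;
* `offcentre_pos`, `offcentre` — every block `Q a b` with `a + b ≠ 0` vanishes (axiality reduces to
  axial sectors; `m < 0` by the reflection `Q ↦ Q(-·,-·)`).
-/

namespace Summit.AnomalousDissipation.AnomalousDissipation.Theorems.MomentParityQuarticGate.AxialQuad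

open Matrix

-- `Summit.<Summit>.<Problem>` is the tree's mandated summit-side namespace (CONVENTIONS §2); for this
-- single-conjunct summit the two coincide, so the duplicate is deliberate.
set_option linter.dupNamespace false

variable (Q : (Fin 3 → ℤ) → (Fin 3 → ℤ) → Matrix (Fin 3) (Fin 3) ℂ) {N : ℕ}

/-- **The isolated self-block at `N = 2`.** In the sector `θ = (0,4,0)` at level `2` the only block
is `Q (0,2,0) (0,2,0)`; all its triads are isosceles, and two of them with independent
polarisations kill it. [folklore] -/
theorem self_block_two (hN : N = 2) (hsupp : (∀ a b : Fin 3 → ℤ, ¬ (((a : Fin 3 → ℤ) ≠ 0 ∧ (a) ⬝ᵥ (a) ≤ ((N : ℕ) : ℤ) ^ 2) ∧ ((b : Fin 3 → ℤ) ≠ 0 ∧ (b) ⬝ᵥ (b) ≤ ((N : ℕ) : ℤ) ^ 2)) → Q a b = 0)) (hrow : ∀ a b, (fun i : Fin 3 => (((a : Fin 3 → ℤ) i : ℤ) : ℂ)) ᵥ* Q a b = 0)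
    (hcol : ∀ a b, Q a b *ᵥ (fun i : Fin 3 => (((b : Fin 3 → ℤ) i : ℤ) : ℂ)) = 0) (hpol : (∀ (k₁ k₂ k₃ : Fin 3 → ℤ) (v₁ v₂ v₃ : Fin 3 → ℂ), ((k₁ : Fin 3 → ℤ) ≠ 0 ∧ (k₁) ⬝ᵥ (k₁) ≤ ((N : ℕ) : ℤ) ^ 2) → ((k₂ : Fin 3 → ℤ) ≠ 0 ∧ (k₂) ⬝ᵥ (k₂) ≤ ((N : ℕ) : ℤ) ^ 2) → ((k₃ : Fin 3 → ℤ) ≠ 0 ∧ (k₃) ⬝ᵥ (k₃) ≤ ((N : ℕ) : ℤ) ^ 2) → v₁ ⬝ᵥ (fun i : Fin 3 => (((k₁ : Fin 3 → ℤ) i : ℤ) : ℂ)) = 0 → v₂ ⬝ᵥ (fun i : Fin 3 => (((k₂ : Fin 3 → ℤ) i : ℤ) : ℂ)) = 0 → v₃ ⬝ᵥ (fun i : Fin 3 => (((k₃ : Fin 3 → ℤ) i : ℤ) : ℂ)) = 0 → (((v₁) ⬝ᵥ (fun i : Fin 3 => (((k₂ : Fin 3 → ℤ) i : ℤ) : ℂ)))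 • (v₂) + ((v₂) ⬝ᵥ (fun i : Fin 3 => (((k₁ : Fin 3 → ℤ) i : ℤ) : ℂ))) • (v₁) : Fin 3 → ℂ) ⬝ᵥ (Q (k₁ + k₂) k₃ *ᵥ v₃) + (((v₁) ⬝ᵥ (fun i : Fin 3 => (((k₃ : Fin 3 → ℤ) i : ℤ) : ℂ))) • (v₃) + ((v₃) ⬝ᵥ (fun i : Fin 3 => (((k₁ : Fin 3 → ℤ) i : ℤ) : ℂ))) • (v₁) : Fin 3 → ℂ) ⬝ᵥ (Q (k₁ + k₃) k₂ *ᵥ v₂) + (((v₂) ⬝ᵥ (fun i : Fin 3 => (((k₃ : Fin 3 → ℤ) i : ℤ) : ℂ))) • (v₃) + ((v₃) ⬝ᵥ (fun i : Fin 3 => (((k₂ : Fin 3 → ℤ) i : ℤ) : ℂ))) • (v₂) : Fin 3 → ℂ) ⬝ᵥ (Q (k₂ + k₃) k₁ *ᵥ v₁) = 0)) : Q ![0, 2, 0] ![0, 2, 0] = 0 := by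
  subst hN
  have hb : ∀ l : Fin 3 → ℤ, l ≠ 0 → l ⬝ᵥ l = 2 → ((l : Fin 3 → ℤ) ≠ 0 ∧ (l) ⬝ᵥ (l) ≤ ((2 : ℕ) : ℤ) ^ 2) := fun l h1 h2 => ⟨h1, by rw [h2]; norm_num⟩
  have b₁ := hb ![1, 1, 0] (by decide) (by rw [vec3_dotProduct]; decide)
  have b₂ := hb ![-1, 1, 0] (by decide) (by rw [vec3_dotProduct]; decide)
  have b₃ := hb ![0, 1, 1] (by decide) (by rw [vec3_dotProduct]; decide)
  have b₄ := hb ![0, 1, -1] (by decide) (by rw [vec3_dotProduct]; decide)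
  have b₀ : ((![0, 2, 0] : Fin 3 → ℤ) ≠ 0 ∧ (![0, 2, 0]) ⬝ᵥ (![0, 2, 0]) ≤ ((2 : ℕ) : ℤ) ^ 2) := ⟨by decide, by rw [vec3_dotProduct]; decide⟩
  have hout : ∀ a c : Fin 3 → ℤ, 5 ≤ a ⬝ᵥ a → Q a c = 0 := fun a c ha =>
    hsupp a c fun h => by have := h.1.2; norm_num at this; linarith
  set M := Q ![0, 2, 0] ![0, 2, 0] with hM
  -- first pair `(1,1,0) + (-1,1,0)`: polarisation `(0,0,2)`
  have hA : ∀ w : Fin 3 → ℂ, w ⬝ᵥ (fun i : Fin 3 => (((![0, 2, 0] : Fin 3 → ℤ) i : ℤ) : ℂ)) = 0 →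
      (fun i : Fin 3 => ((((![1, 1, 0] ⨯₃ ![-1, 1, 0]) : Fin 3 → ℤ) i : ℤ) : ℂ)) ⬝ᵥ (M *ᵥ w) = 0 := fun w hw =>
    normal_dotProduct_mulVec_eq_zero _ _ (by rw [cross_apply]; decide) M w fun x y hx hy => by
      have h := hpol ![1, 1, 0] ![-1, 1, 0] ![0, 2, 0] x y w b₁ b₂ b₀ hx hy hw
      have e1 : (![1, 1, 0] + ![-1, 1, 0] : Fin 3 → ℤ) = ![0, 2, 0] := by decide
      have e2 : (![1, 1, 0] + ![0, 2, 0] : Fin 3 → ℤ) = ![1, 3, 0] := by decide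
      have e3 : (![-1, 1, 0] + ![0, 2, 0] : Fin 3 → ℤ) = ![-1, 3, 0] := by decide
      rwa [e1, e2, e3, hout ![1, 3, 0] _ (by rw [vec3_dotProduct]; decide),
        hout ![-1, 3, 0] _ (by rw [vec3_dotProduct]; decide), Matrix.zero_mulVec, Matrix.zero_mulVec,
        dotProduct_zero, dotProduct_zero, add_zero, add_zero] at h
  -- second pair `(0,1,1) + (0,1,-1)`: polarisation `(-2,0,0)`
  have hB : ∀ w : Fin 3 → ℂ, w ⬝ᵥ (fun i : Fin 3 => (((![0, 2, 0] : Fin 3 → ℤ) i : ℤ) : ℂ)) = 0 →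
      (fun i : Fin 3 => ((((![0, 1, 1] ⨯₃ ![0, 1, -1]) : Fin 3 → ℤ) i : ℤ) : ℂ)) ⬝ᵥ (M *ᵥ w) = 0 := fun w hw =>
    normal_dotProduct_mulVec_eq_zero _ _ (by rw [cross_apply]; decide) M w fun x y hx hy => by
      have h := hpol ![0, 1, 1] ![0, 1, -1] ![0, 2, 0] x y w b₃ b₄ b₀ hx hy hw
      have e1 : (![0, 1, 1] + ![0, 1, -1] : Fin 3 → ℤ) = ![0, 2, 0] := by decide
      have e2 : (![0, 1, 1] + ![0, 2, 0] : Fin 3 → ℤ) = ![0, 3, 1] := by decide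
      have e3 : (![0, 1, -1] + ![0, 2, 0] : Fin 3 → ℤ) = ![0, 3, -1] := by decide
      rwa [e1, e2, e3, hout ![0, 3, 1] _ (by rw [vec3_dotProduct]; decide),
        hout ![0, 3, -1] _ (by rw [vec3_dotProduct]; decide), Matrix.zero_mulVec, Matrix.zero_mulVec,
        dotProduct_zero, dotProduct_zero, add_zero, add_zero] at h
  refine matrix_eq_zero_of_mulVec_transverse ![0, 2, 0] (by decide) M (hcol _ _) fun w hw => ?_
  refine eq_zero_of_three_dotProduct _ _ ![0, 2, 0]
    (by rw [cross_apply, cross_apply, Matrix.det_fin_three]; decide) _ (hA w hw) (hB w hw) ?_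
  rw [Matrix.dotProduct_mulVec, hrow, zero_dotProduct]

/-- **Collinear kill.** A block `Q (0,s,0) b` of an axial sector with `1 + s² ≤ N²` dies by
`(POL)((1,0,0), (-1,s,0), b)` once the two companions are dead. [folklore] -/
theorem coll_kill (hrow : ∀ a b, (fun i : Fin 3 => (((a : Fin 3 → ℤ) i : ℤ) : ℂ)) ᵥ* Q a b = 0) (hcol : ∀ a b, Q a b *ᵥ (fun i : Fin 3 => (((b : Fin 3 → ℤ) i : ℤ) : ℂ)) = 0)
    (hpol : (∀ (k₁ k₂ k₃ : Fin 3 → ℤ) (v₁ v₂ v₃ : Fin 3 → ℂ), ((k₁ : Fin 3 → ℤ) ≠ 0 ∧ (k₁) ⬝ᵥ (k₁) ≤ ((N : ℕ) : ℤ) ^ 2) → ((k₂ : Fin 3 → ℤ) ≠ 0 ∧ (k₂) ⬝ᵥ (k₂) ≤ ((N : ℕ) : ℤ) ^ 2) → ((k₃ : Fin 3 → ℤ) ≠ 0 ∧ (k₃) ⬝ᵥ (k₃) ≤ ((N : ℕ) : ℤ) ^ 2) → v₁ ⬝ᵥ (fun i : Fin 3 => (((k₁ : Fin 3 → ℤ)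 i : ℤ) : ℂ)) = 0 → v₂ ⬝ᵥ (fun i : Fin 3 => (((k₂ : Fin 3 → ℤ) i : ℤ) : ℂ)) = 0 → v₃ ⬝ᵥ (fun i : Fin 3 => (((k₃ : Fin 3 → ℤ) i : ℤ) : ℂ)) = 0 → (((v₁) ⬝ᵥ (fun i : Fin 3 => (((k₂ : Fin 3 → ℤ) i : ℤ) : ℂ))) • (v₂) + ((v₂) ⬝ᵥ (fun i : Fin 3 => (((k₁ : Fin 3 → ℤ) i : ℤ) : ℂ))) • (v₁) : Fin 3 → ℂ) ⬝ᵥ (Q (k₁ + k₂) k₃ *ᵥ v₃) + (((v₁) ⬝ᵥ (fun i : Fin 3 => (((k₃ : Fin 3 → ℤ) i : ℤ) : ℂ))) • (v₃) + ((v₃) ⬝ᵥ (fun i : Fin 3 => (((k₁ : Fin 3 → ℤ) i : ℤ) : ℂ))) • (v₁) : Fin 3 → ℂ) ⬝ᵥ (Q (k₁ + k₃) k₂ *ᵥ v₂) + (((v₂) ⬝ᵥ (fun i : Fin 3 => (((k₃ : Fin 3 → ℤ) i : ℤ) : ℂ))) • (v₃) + ((v₃) ⬝ᵥ (fun i : Fin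 3 => (((k₂ : Fin 3 → ℤ) i : ℤ) : ℂ))) • (v₂) : Fin 3 → ℂ) ⬝ᵥ (Q (k₂ + k₃) k₁ *ᵥ v₁) = 0)) {s : ℤ} (hs0 : s ≠ 0) (hsN : 1 + s * s ≤ ((N : ℕ) : ℤ) ^ 2)
    {b : Fin 3 → ℤ} (hb : ((b : Fin 3 → ℤ) ≠ 0 ∧ (b) ⬝ᵥ (b) ≤ ((N : ℕ) : ℤ) ^ 2)) (hd₁ : Q (![1, 0, 0] + b) ![-1, s, 0] = 0)
    (hd₂ : Q (![-1, s, 0] + b) ![1, 0, 0] = 0) : Q ![0, s, 0] b = 0 := by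
  have e : (![1, 0, 0] + ![-1, s, 0] : Fin 3 → ℤ) = ![0, s, 0] := by
    ext i; fin_cases i <;> simp
  have b₁ : ((![1, 0, 0] : Fin 3 → ℤ) ≠ 0 ∧ (![1, 0, 0]) ⬝ᵥ (![1, 0, 0]) ≤ ((N : ℕ) : ℤ) ^ 2) := ⟨by decide, by rw [vec3_dotProduct]; simp; nlinarith⟩
  have b₂ : ((![-1, s, 0] : Fin 3 → ℤ) ≠ 0 ∧ (![-1, s, 0]) ⬝ᵥ (![-1, s, 0]) ≤ ((N : ℕ) : ℤ) ^ 2) := ⟨fun h => by simpa using congrFun h 0, by rw [vec3_dotProduct]; simpa using hsN⟩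
  have h := kill_step Q hrow hcol hpol b₁ b₂ hb (fun h => hs0 (by simpa [cross_apply] using congrFun h 2))
    (by rw [vec3_dotProduct, vec3_dotProduct]; simp; intro h; exact hs0 (by nlinarith)) hd₁ hd₂
  rwa [e] at h

/-- An axial vector in coordinates. [folklore] -/
theorem axial_eq {θ : Fin 3 → ℤ} (hθ0 : θ 0 = 0) (hθ2 : θ 2 = 0) : θ = ![0, θ 1, 0] := by
  ext i; fin_cases i <;> simp [hθ0, hθ2]

/-- A vector collinear with a nonzero axial vector is axial. [folklore] -/
theorem axial_of_cross_eq_zero {θ a : Fin 3 → ℤ} (hθ0 : θ 0 = 0) (hθ2 : θ 2 = 0) (hm : θ 1 ≠ 0)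
    (h : a ⨯₃ θ = 0) : a = ![0, a 1, 0] := by
  have h0 := congrFun h 0
  have h2 := congrFun h 2
  simp only [cross_apply, hθ0, hθ2, mul_zero, zero_sub, sub_zero, cons_val_zero, cons_val_two,
    tail_cons, head_cons, Pi.zero_apply, neg_eq_zero, mul_eq_zero, hm, or_false] at h0 h2
  ext i; fin_cases i <;> simp [h0, h2]

set_option maxHeartbeats 1600000 in
-- a long case analysis in one declaration
/-- **The thin lens: `θ` outside the ball.** For an axial `θ = (0,m,0)` with `m > 0` and
`|θ|² > N²` (`N ≥ 2`), every block of the sector dies: induction on the height of the lower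
member. [folklore] -/
theorem offcentre_of_not_mem (hN : 2 ≤ N) (hsupp : (∀ a b : Fin 3 → ℤ, ¬ (((a : Fin 3 → ℤ) ≠ 0 ∧ (a) ⬝ᵥ (a) ≤ ((N : ℕ) : ℤ) ^ 2) ∧ ((b : Fin 3 → ℤ) ≠ 0 ∧ (b) ⬝ᵥ (b) ≤ ((N : ℕ) : ℤ) ^ 2)) → Q a b = 0)) (hsymm : ∀ a b, Q b a = (Q a b)ᵀ)
    (hrow : ∀ a b, (fun i : Fin 3 => (((a : Fin 3 → ℤ) i : ℤ) : ℂ)) ᵥ* Q a b = 0) (hcol : ∀ a b, Q a b *ᵥ (fun i : Fin 3 => (((b : Fin 3 → ℤ) i : ℤ) : ℂ)) = 0) (hpol : (∀ (k₁ k₂ k₃ : Fin 3 → ℤ) (v₁ v₂ v₃ : Fin 3 → ℂ), ((k₁ : Fin 3 → ℤ) ≠ 0 ∧ (k₁) ⬝ᵥ (k₁) ≤ ((N : ℕ) : ℤ) ^ 2) → ((k₂ : Fin 3 → ℤ) ≠ 0 ∧ (k₂) ⬝ᵥ (k₂) ≤ ((N : ℕ) : ℤ) ^ 2) → ((k₃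 : Fin 3 → ℤ) ≠ 0 ∧ (k₃) ⬝ᵥ (k₃) ≤ ((N : ℕ) : ℤ) ^ 2) → v₁ ⬝ᵥ (fun i : Fin 3 => (((k₁ : Fin 3 → ℤ) i : ℤ) : ℂ)) = 0 → v₂ ⬝ᵥ (fun i : Fin 3 => (((k₂ : Fin 3 → ℤ) i : ℤ) : ℂ)) = 0 → v₃ ⬝ᵥ (fun i : Fin 3 => (((k₃ : Fin 3 → ℤ) i : ℤ) : ℂ)) = 0 → (((v₁) ⬝ᵥ (fun i : Fin 3 => (((k₂ : Fin 3 → ℤ) i : ℤ) : ℂ))) • (v₂) + ((v₂) ⬝ᵥ (fun i : Fin 3 => (((k₁ : Fin 3 → ℤ) i : ℤ) : ℂ))) • (v₁) : Fin 3 → ℂ) ⬝ᵥ (Q (k₁ + k₂) k₃ *ᵥ v₃) + (((v₁) ⬝ᵥ (fun i : Fin 3 => (((k₃ : Fin 3 → ℤ) i : ℤ) : ℂ))) • (v₃) + ((v₃) ⬝ᵥ (fun i : Fin 3 => (((k₁ : Fin 3 → ℤ) i : ℤ) : ℂ))) • (v₁) : Fin 3 → ℂ) ⬝ᵥ (Q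 (k₁ + k₃) k₂ *ᵥ v₂) + (((v₂) ⬝ᵥ (fun i : Fin 3 => (((k₃ : Fin 3 → ℤ) i : ℤ) : ℂ))) • (v₃) + ((v₃) ⬝ᵥ (fun i : Fin 3 => (((k₂ : Fin 3 → ℤ) i : ℤ) : ℂ))) • (v₂) : Fin 3 → ℂ) ⬝ᵥ (Q (k₂ + k₃) k₁ *ᵥ v₁) = 0))
    {θ : Fin 3 → ℤ} (hθ0 : θ 0 = 0) (hθ2 : θ 2 = 0) (hm : 0 < θ 1)
    (hout : ((N : ℕ) : ℤ) ^ 2 < θ ⬝ᵥ θ) (a b : Fin 3 → ℤ) (hab : a + b = θ) : Q a b = 0 := by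
  have hNm : ((N : ℕ) : ℤ) < θ 1 := by
    rw [vec3_dotProduct, hθ0, hθ2] at hout; nlinarith
  -- support: a member of nonpositive height has its partner outside the ball
  have hlow : ∀ a b : Fin 3 → ℤ, a + b = θ → a 1 ≤ 0 → Q a b = 0 ∧ Q b a = 0 := by
    intro a b hab ha
    have hb : ¬ ((b : Fin 3 → ℤ) ≠ 0 ∧ (b) ⬝ᵥ (b) ≤ ((N : ℕ) : ℤ) ^ 2) := fun h => by
      have h2 := h.2
      have : b 1 = θ 1 - a 1 := by rw [← hab]; simp
      rw [vec3_dotProduct] at h2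
      nlinarith [mul_self_nonneg (b 0), mul_self_nonneg (b 2)]
    exact ⟨hsupp a b fun h => hb h.2, hsupp b a fun h => hb h.1⟩
  -- induction on the height of the first member, both orientations
  suffices H : ∀ n : ℕ, ∀ a b : Fin 3 → ℤ, a + b = θ → a 1 ≤ n → Q a b = 0 ∧ Q b a = 0 by
    rcases le_or_gt (a 1) 0 with h | h
    · exact (hlow a b hab h).1
    · exact (H (a 1).toNat a b hab (Int.self_le_toNat _)).1
  intro n
  induction n with
  | zero => intro a b hab ha; exact hlow a b hab (by exact_mod_cast ha)
  | succ n ih =>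
    -- stage `ℓ = n + 1`: first the non-collinear pairs, then the collinear one
    have hNC : ∀ a b : Fin 3 → ℤ, a + b = θ → a 1 ≤ n + 1 → a ⨯₃ θ ≠ 0 → Q a b = 0 ∧ Q b a = 0 := by
      intro a b hab ha hnc
      rcases lt_or_eq_of_le ha with hlt | heq
      · exact ih a b hab (by omega)
      by_cases hmem : ((a : Fin 3 → ℤ) ≠ 0 ∧ (a) ⬝ᵥ (a) ≤ ((N : ℕ) : ℤ) ^ 2) ∧ ((b : Fin 3 → ℤ) ≠ 0 ∧ (b) ⬝ᵥ (b) ≤ ((N : ℕ) : ℤ) ^ 2)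
      swap
      · exact ⟨hsupp a b hmem, hsupp b a fun h => hmem ⟨h.2, h.1⟩⟩
      obtain ⟨hA, hB⟩ := hmem
      have hb1 : b 1 = θ 1 - a 1 := by rw [← hab]; simp
      rcases le_or_gt (b 1) n with hbn | hbn
      · have := ih b a ((add_comm b a).trans hab) (by exact_mod_cast hbn)
        exact ⟨this.2, this.1⟩
      -- `a` is the lower member, of height `ℓ = n + 1 ≥ 2`
      have hperp : a 0 ≠ 0 ∨ a 2 ≠ 0 := by
        by_contra h
        push Not at h
        exact hnc (by rw [axial_eq hθ0 hθ2]; ext i; fin_cases i <;> simp [cross_apply, h.1, h.2])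
      have hℓ2 : (2 : ℤ) ≤ n + 1 := by
        -- if `ℓ = 1` then `b₁ = m - 1 ≥ N`, so `b = (0, N, 0)` and `a` would be axial
        by_contra hlt
        have ha1 : a 1 = 1 := by omega
        have hB2 := hB.2
        rw [vec3_dotProduct] at hB2
        have hb1N : b 1 = (N : ℤ) := by nlinarith [mul_self_nonneg (b 0), mul_self_nonneg (b 2)]
        have hb0 : b 0 * b 0 + b 2 * b 2 ≤ 0 := by nlinarith
        have hb00 : b 0 = 0 := mul_self_eq_zero.1 (by nlinarith [mul_self_nonneg (b 0), mul_self_nonneg (b 2)])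
        have hb20 : b 2 = 0 := mul_self_eq_zero.1 (by nlinarith [mul_self_nonneg (b 0), mul_self_nonneg (b 2)])
        have ha0 : a 0 = 0 := by have := congrFun hab 0; simp only [Pi.add_apply, hb00, hθ0] at this; linarith
        have ha2 : a 2 = 0 := by have := congrFun hab 2; simp only [Pi.add_apply, hb20, hθ2] at this; linarith
        exact hperp.elim (fun h => h ha0) (fun h => h ha2)
      -- the decomposition `a = (a₀, ℓ - t, a₂) + (0, t, 0)`
      set t : ℤ := (n + 1) / 2 with ht
      have ht1 : 1 ≤ t := by omega
      have ht2 : t ≤ n + 1 - t := by omega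
      set k₂ : Fin 3 → ℤ := ![0, t, 0] with hk₂
      set k₁ : Fin 3 → ℤ := a - k₂ with hk₁
      have hk₁v : k₁ = ![a 0, a 1 - t, a 2] := by
        ext i; fin_cases i <;> simp [hk₁, hk₂, Matrix.vecHead, Matrix.vecTail]
      have e : k₁ + k₂ = a := by rw [hk₁]; abel
      have hA2 := hA.2
      rw [vec3_dotProduct] at hA2
      have hk₂B : ((k₂ : Fin 3 → ℤ) ≠ 0 ∧ (k₂) ⬝ᵥ (k₂) ≤ ((N : ℕ) : ℤ) ^ 2) := ⟨fun h => by have := congrFun h 1; simp [hk₂] at this; omega,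
        by rw [hk₂, vec3_dotProduct]; simp; nlinarith [mul_self_nonneg (a 0), mul_self_nonneg (a 2)]⟩
      have hk₁B : ((k₁ : Fin 3 → ℤ) ≠ 0 ∧ (k₁) ⬝ᵥ (k₁) ≤ ((N : ℕ) : ℤ) ^ 2) := by
        refine ⟨fun h => ?_, ?_⟩
        · rcases hperp with h' | h'
          · exact h' (by simpa [hk₁v] using congrFun h 0)
          · exact h' (by simpa [hk₁v] using congrFun h 2)
        · rw [hk₁v, vec3_dotProduct]; simp; nlinarith
      have hn' : k₁ ⨯₃ k₂ ≠ 0 := by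
        intro h
        rcases hperp with h' | h'
        · exact h' (by have := congrFun h 2; simp [hk₁v, hk₂, cross_apply] at this; omega)
        · exact h' (by have := congrFun h 0; simp [hk₁v, hk₂, cross_apply] at this; omega)
      have hlen : k₁ ⬝ᵥ k₁ ≠ k₂ ⬝ᵥ k₂ := by
        rw [hk₁v, hk₂, vec3_dotProduct, vec3_dotProduct]; simp
        have : 1 ≤ a 0 * a 0 + a 2 * a 2 := by
          rcases hperp with h' | h'
          · nlinarith [mul_self_nonneg (a 2), Int.one_le_abs h', abs_mul_abs_self (a 0)]
          · nlinarith [mul_self_nonneg (a 0), Int.one_le_abs h', abs_mul_abs_self (a 2)]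
        nlinarith
      -- the companions are dead by the induction hypothesis (lower first members)
      have hd₁ : Q (k₁ + b) k₂ = 0 :=
        (ih k₂ (k₁ + b) (by rw [← hab, ← e]; abel) (by simp [hk₂]; omega)).2
      have hd₂ : Q (k₂ + b) k₁ = 0 :=
        (ih k₁ (k₂ + b) (by rw [← hab, ← e]; abel) (by simp [hk₁v]; omega)).2
      have h := kill_step Q hrow hcol hpol hk₁B hk₂B hB hn' hlen hd₁ hd₂
      rw [e] at h
      exact ⟨h, eq_zero_of_transpose Q hsymm h⟩
    -- now an arbitrary pair of the stage
    intro a b hab ha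
    by_cases hnc : a ⨯₃ θ ≠ 0
    · exact hNC a b hab ha hnc
    push Not at hnc
    rcases lt_or_eq_of_le ha with hlt | heq
    · exact ih a b hab (by omega)
    by_cases hmem : ((a : Fin 3 → ℤ) ≠ 0 ∧ (a) ⬝ᵥ (a) ≤ ((N : ℕ) : ℤ) ^ 2) ∧ ((b : Fin 3 → ℤ) ≠ 0 ∧ (b) ⬝ᵥ (b) ≤ ((N : ℕ) : ℤ) ^ 2)
    swap
    · exact ⟨hsupp a b hmem, hsupp b a fun h => hmem ⟨h.2, h.1⟩⟩
    obtain ⟨hA, hB⟩ := hmem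
    have hb1 : b 1 = θ 1 - a 1 := by rw [← hab]; simp
    rcases le_or_gt (b 1) n with hbn | hbn
    · have := ih b a ((add_comm b a).trans hab) (by exact_mod_cast hbn)
      exact ⟨this.2, this.1⟩
    have hav := axial_of_cross_eq_zero hθ0 hθ2 hm.ne' hnc
    have hA2 := hA.2
    rw [hav, vec3_dotProduct] at hA2
    simp only [cons_val_zero, cons_val_one, cons_val_two, head_cons, tail_cons, mul_zero, zero_add,
      add_zero] at hA2
    suffices hQ : Q a b = 0 from ⟨hQ, eq_zero_of_transpose Q hsymm hQ⟩
    have haN : a 1 ≤ (N : ℤ) := (abs_le_of_sq_le_sq' (by rw [sq]; exact hA2) (Nat.cast_nonneg N)).2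
    have hθsq : ((N : ℕ) : ℤ) * N < θ 1 * θ 1 := by
      have h1 := mul_self_le_mul_self (by positivity) (show ((N : ℕ) : ℤ) + 1 ≤ θ 1 by omega)
      have e : (((N : ℕ) : ℤ) + 1) * (((N : ℕ) : ℤ) + 1) = ((N : ℕ) : ℤ) * N + 2 * N + 1 := by ring
      rw [e] at h1
      have h0 : (0 : ℤ) ≤ N := Nat.cast_nonneg N
      linarith
    rcases lt_or_eq_of_le haN with hltN | heqN
    · -- `ℓ ≤ N - 1`: `(1,0,0) + (-1,ℓ,0)`; companion `(-1, ℓ, 0)` is non-collinear of height `ℓ`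
      have hsN : 1 + a 1 * a 1 ≤ ((N : ℕ) : ℤ) ^ 2 := by
        clear hNC ih hlow hpol
        have h0 : 0 ≤ a 1 + 1 := by omega
        have h1 : a 1 + 1 ≤ ((N : ℕ) : ℤ) := by omega
        have hsq : (a 1 + 1) * (a 1 + 1) ≤ ((N : ℕ) : ℤ) * N := mul_self_le_mul_self h0 h1
        have e : (a 1 + 1) * (a 1 + 1) = a 1 * a 1 + 2 * a 1 + 1 := by ring
        rw [sq]; rw [e] at hsq; linarith
      have hs0 : a 1 ≠ 0 := by omega
      have hb0 : b 0 = 0 := by have := congrFun hab 0; rw [hav] at this; simpa [hθ0] using this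
      have hb2 : b 2 = 0 := by have := congrFun hab 2; rw [hav] at this; simpa [hθ2] using this
      have hsum' : ![-1, a 1, 0] + (![1, 0, 0] + b) = θ := by
        ext i; fin_cases i <;> simp [hb0, hb2, hb1, hθ0, hθ2, Matrix.vecHead, Matrix.vecTail]
      have hnc' : ![-1, a 1, 0] ⨯₃ θ ≠ 0 := fun h => by
        have := congrFun h 2; simp [cross_apply, hθ0] at this; omega
      have hd₁ : Q (![1, 0, 0] + b) ![-1, a 1, 0] = 0 := (hNC _ _ hsum' (by simp [heq]) hnc').2
      have hout' : ¬ (((![-1, a 1, 0] + b : Fin 3 → ℤ) ≠ 0 ∧ (![-1, a 1, 0] + b) ⬝ᵥ (![-1, a 1, 0] + b) ≤ ((N : ℕ) : ℤ) ^ 2) ∧ ((![1, 0, 0] : Fin 3 → ℤ) ≠ 0 ∧ (![1, 0, 0]) ⬝ᵥ (![1, 0, 0]) ≤ ((N : ℕ) : ℤ) ^ 2)) := fun h => by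
        have h2 := h.1.2
        have e : (![-1, a 1, 0] + b) = ![-1, θ 1, 0] := by
          ext i; fin_cases i <;> simp [hb0, hb2, hb1]
        rw [e, vec3_dotProduct, sq] at h2
        simp only [cons_val_zero, cons_val_one, cons_val_two, head_cons, tail_cons, mul_zero, add_zero,
          mul_neg, mul_one, neg_neg] at h2
        clear hNC ih hlow hpol hd₁ e h
        linarith
      have hd₂ : Q (![-1, a 1, 0] + b) ![1, 0, 0] = 0 := hsupp _ _ hout'
      have key := coll_kill Q hrow hcol hpol hs0 hsN hB hd₁ hd₂
      rwa [← hav] at key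
    · -- `ℓ = N`: then `b = (0, N, 0) = a`, `m = 2N`: the self-block
      have hB2 := hB.2
      rw [vec3_dotProduct, sq] at hB2
      have hb1le : b 1 ≤ (N : ℤ) :=
        (abs_le_of_sq_le_sq' (by rw [sq, sq]; nlinarith [mul_self_nonneg (b 0), mul_self_nonneg (b 2)])
          (Nat.cast_nonneg N)).2
      have hb1N : b 1 = (N : ℤ) := by omega
      rw [hb1N] at hB2
      have hb00 : b 0 = 0 :=
        mul_self_eq_zero.1 (by nlinarith [mul_self_nonneg (b 0), mul_self_nonneg (b 2)])
      have hb20 : b 2 = 0 :=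
        mul_self_eq_zero.1 (by nlinarith [mul_self_nonneg (b 0), mul_self_nonneg (b 2)])
      have hbv : b = ![0, (N : ℤ), 0] := by ext i; fin_cases i <;> simp [hb00, hb20, hb1N]
      rw [hav, hbv, heqN]
      rcases lt_or_eq_of_le hN with hN3 | hN2
      · -- `N ≥ 3`: `(1,1,0) + (-1,N-1,0)`, companions outside the ball
        have hN3' : (3 : ℤ) ≤ N := by exact_mod_cast hN3
        have hNN : (9 : ℤ) ≤ (N : ℤ) * N := le_trans (by norm_num) (mul_self_le_mul_self (by norm_num) hN3')
        have e : (![1, 1, 0] + ![-1, (N : ℤ) - 1, 0] : Fin 3 → ℤ) = ![0, (N : ℤ), 0] := by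
          ext i; fin_cases i <;> simp
        have b₁ : ((![1, 1, 0] : Fin 3 → ℤ) ≠ 0 ∧ (![1, 1, 0]) ⬝ᵥ (![1, 1, 0]) ≤ ((N : ℕ) : ℤ) ^ 2) := ⟨by decide, by rw [vec3_dotProduct, sq]; simp; omega⟩
        have b₂ : ((![-1, (N : ℤ) - 1, 0] : Fin 3 → ℤ) ≠ 0 ∧ (![-1, (N : ℤ) - 1, 0]) ⬝ᵥ (![-1, (N : ℤ) - 1, 0]) ≤ ((N : ℕ) : ℤ) ^ 2) := ⟨fun h => by simpa using congrFun h 0, by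
          rw [vec3_dotProduct, sq]; simp only [cons_val_zero, cons_val_one, cons_val_two, head_cons, tail_cons,
            mul_neg, mul_one, neg_neg, mul_zero, add_zero]; nlinarith⟩
        have b₀ : ((![0, (N : ℤ), 0] : Fin 3 → ℤ) ≠ 0 ∧ (![0, (N : ℤ), 0]) ⬝ᵥ (![0, (N : ℤ), 0]) ≤ ((N : ℕ) : ℤ) ^ 2) := ⟨fun h => by have := congrFun h 1; simp at this; omega,
          by rw [vec3_dotProduct, sq]; simp⟩
        have h := kill_step Q hrow hcol hpol b₁ b₂ b₀
          (fun h => by have := congrFun h 2; simp [cross_apply] at this; omega)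
          (by rw [vec3_dotProduct, vec3_dotProduct]; simp only [cons_val_zero, cons_val_one, cons_val_two,
                head_cons, tail_cons, mul_neg, mul_one, neg_neg, mul_zero, add_zero]; nlinarith)
          (hsupp _ _ fun h => by
            have h2 := h.1.2; rw [vec3_dotProduct, sq] at h2
            simp only [Pi.add_apply, cons_val_zero, cons_val_one, cons_val_two, head_cons, tail_cons, add_zero,
              mul_one, mul_zero] at h2; nlinarith)
          (hsupp _ _ fun h => by
            have h2 := h.1.2; rw [vec3_dotProduct, sq] at h2
            simp only [Pi.add_apply, cons_val_zero, cons_val_one, cons_val_two, head_cons, tail_cons, add_zero,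
              mul_neg, mul_one, neg_neg, mul_zero] at h2; nlinarith)
        rwa [e] at h
      · -- `N = 2`
        subst hN2
        exact self_block_two Q rfl hsupp hrow hcol hpol

end Summit.AnomalousDissipation.AnomalousDissipation.Theorems.MomentParityQuarticGate.AxialQuad

namespace Summit.AnomalousDissipation.AnomalousDissipation.Theorems.MomentParityQuarticGate

-- the summit-side namespace repeats `AnomalousDissipation` by the tree's convention
set_option linter.dupNamespace false in
/-- **Registered sub-goal `axialQuad_offB` of stub S2q** (summary of this file): for an axial `θ = (0,m,0)`, `m > 0`, outside the ball, every block `Q a b`, `a + b = θ`, vanishes. [folklore] -/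
theorem axialQuad_offB : ∀ (Q : ((Fin 3 → ℤ) → (Fin 3 → ℤ) → Matrix (Fin 3) (Fin 3) ℂ)) (N : ℕ), 2 ≤ N → (∀ a b : Fin 3 → ℤ, ¬ (((a : Fin 3 → ℤ) ≠ 0 ∧ (a) ⬝ᵥ (a) ≤ ((N : ℕ) : ℤ) ^ 2) ∧ ((b : Fin 3 → ℤ) ≠ 0 ∧ (b) ⬝ᵥ (b) ≤ ((N : ℕ) : ℤ) ^ 2)) → Q a b = 0) → (∀ a b : Fin 3 → ℤ, Q b a = Matrix.transpose (Q a b)) → (∀ a b : Fin 3 → ℤ, Matrix.vecMul (fun i : Fin 3 => (((a : Fin 3 → ℤ) i : ℤ) : ℂ)) (Q a b) = 0) → (∀ a b : Fin 3 → ℤ, Matrix.mulVec (Q a b) (fun i : Fin 3 => (((b : Fin 3 → ℤ) i : ℤ) : ℂ)) = 0) → (∀ (k₁ k₂ k₃ : Fin 3 → ℤ) (v₁ v₂ v₃ : Fin 3 → ℂ), ((k₁ : Fin 3 → ℤ) ≠ 0 ∧ (k₁) ⬝ᵥ (k₁) ≤ ((N : ℕ) : ℤ) ^ 2) → ((k₂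 : Fin 3 → ℤ) ≠ 0 ∧ (k₂) ⬝ᵥ (k₂) ≤ ((N : ℕ) : ℤ) ^ 2) → ((k₃ : Fin 3 → ℤ) ≠ 0 ∧ (k₃) ⬝ᵥ (k₃) ≤ ((N : ℕ) : ℤ) ^ 2) → v₁ ⬝ᵥ (fun i : Fin 3 => (((k₁ : Fin 3 → ℤ) i : ℤ) : ℂ)) = 0 → v₂ ⬝ᵥ (fun i : Fin 3 => (((k₂ : Fin 3 → ℤ) i : ℤ) : ℂ)) = 0 → v₃ ⬝ᵥ (fun i : Fin 3 => (((k₃ : Fin 3 → ℤ) i : ℤ) : ℂ)) = 0 → (((v₁) ⬝ᵥ (fun i : Fin 3 => (((k₂ : Fin 3 → ℤ) i : ℤ) : ℂ))) • (v₂) + ((v₂) ⬝ᵥ (fun i : Fin 3 => (((k₁ : Fin 3 → ℤ) i : ℤ) : ℂ))) • (v₁) : Fin 3 → ℂ) ⬝ᵥ (Matrix.mulVec (Q (k₁ + k₂) k₃) v₃) + (((v₁) ⬝ᵥ (fun i : Fin 3 => (((k₃ : Fin 3 → ℤ) i : ℤ) : ℂ))) • (v₃) + ((v₃) ⬝ᵥ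 (fun i : Fin 3 => (((k₁ : Fin 3 → ℤ) i : ℤ) : ℂ))) • (v₁) : Fin 3 → ℂ) ⬝ᵥ (Matrix.mulVec (Q (k₁ + k₃) k₂) v₂) + (((v₂) ⬝ᵥ (fun i : Fin 3 => (((k₃ : Fin 3 → ℤ) i : ℤ) : ℂ))) • (v₃) + ((v₃) ⬝ᵥ (fun i : Fin 3 => (((k₂ : Fin 3 → ℤ) i : ℤ) : ℂ))) • (v₂) : Fin 3 → ℂ) ⬝ᵥ (Matrix.mulVec (Q (k₂ + k₃) k₁) v₁) = 0) → ∀ (θ : Fin 3 → ℤ), θ 0 = 0 → θ 2 = 0 → 0 < θ 1 → ((N : ℕ) : ℤ) ^ 2 < θ ⬝ᵥ θ → ∀ (a b : Fin 3 → ℤ), a + b = θ → Q a b = 0 :=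
  fun Q _ hN hsupp hsymm hrow hcol hpol _ hθ0 hθ2 hm hout a b hab => AxialQuad.offcentre_of_not_mem Q hN hsupp hsymm hrow hcol hpol hθ0 hθ2 hm hout a b hab

end Summit.AnomalousDissipation.AnomalousDissipation.Theorems.MomentParityQuarticGate
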